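import Mathlib
import HarnessLib
import Summits.NavierStokesRegularity.NavierStokesRegularity.Theorems.HalfSpaceWindowDoorCirculationCarryingRigidityEddyMeans
import Summits.NavierStokesRegularity.NavierStokesRegularity.Theorems.HalfSpaceWindowDoorCirculationCarryingRigidityFlatTools

/-!
# Route `HalfSpaceWindowDoor`, crux `CirculationCarryingRigidity` (stmt-NavierStokesRegularity-25311) — line `eddy_covariance`:
# the circle integrals `∮ω₃ dl`, `∮ω_r dl` at a TOUCHING point of the penalised barrier (kinematics for `…FlatBarrier`)

LEAD ns-hsw-p1 g10, `--supports 25311 --as helper`; card `Cruxes/…/Lines/eddy_covariance.md`.  If the comparison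
`q = (2π)⁻¹Γ(|x_h|,x₂,t) − (2π)⁻¹(μ + κ|x_h|²)` has spatial gradient `∇q(x) = ε·E·2x` at an off-axis point `x` (the touching condition of
`…TouchingMaxPrinciple.le_of_subsolution_touching`, `E = e^{K(t−s₀)}`), then on the circle `S(|x_h|, x₂)` at time `t`
`∮ω₃ dl = (4πεE + 2κ)|x_h|` (`vortCirc_of_touching`) and `∮ω_r dl = −4πεE x₂` (`radVortCirc_of_touching`): Stokes `DF[e_r] = (2π)⁻¹∮ω₃ dl`,
`DF[e_z] = −(2π)⁻¹∮ω_r dl` (`…EddyMeans.fderiv_circF_eZ`), `⟪x, e_r⟫ = |x_h|`, `⟪x, e_z⟫ = x₂`, `Dφ[e_r] = (2π)⁻¹·2κ|x_h|`, `Dφ[e_z] = 0`.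
WHAT THIS IS NOT: not about NS regularity; kinematics of HYPOTHETICAL blow-up profiles.  No item is closed by this file.
-/

noncomputable section

-- the summit and its single sub-problem share the name (CONVENTIONS §1), as in every Theorems file
set_option linter.dupNamespace false

namespace Summit.NavierStokesRegularity.NavierStokesRegularity.Theorems.HalfSpaceWindowDoorCirculationCarryingRigidityFlatTouching

open MeasureTheory Set Function Filter Topology InnerProductSpace
open scoped RealInnerProductSpace InnerProductSpace Laplacian
open Literature.Analysis Literature.Analysis.UnboundedOperators
open Literature.Analysis.FluidPDE hiding eR
open Summit.NavierStokesRegularity.NavierStokesRegularity.Theorems.HalfSpaceWindowDoorCirculationCarryingRigidityDefs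
  (InDoorClass SignE3 e3)
open Summit.NavierStokesRegularity.NavierStokesRegularity.Theorems.AxisTwistDoorAveragedConeLiouvilleDefs
  (cylPt eT eR circ vortCirc radVortCirc tiltCirc circleTerm meanR meanZ remainder)
open Summit.NavierStokesRegularity.NavierStokesRegularity.Theorems.AveragedConeLiouville.CircleStokes (continuous_eR)
open Summit.NavierStokesRegularity.NavierStokesRegularity.Theorems.AxisTwistDoorAveragedConeLiouvilleCylFrame
  (continuous_cylPt_θ abs_inner_eR_le abs_inner_e3_le abs_integral_le_const_mul_add norm_eR)
open Summit.NavierStokesRegularity.NavierStokesRegularity.Theorems.AveragedConeLiouville.CircleStokes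
  (deriv_circ_eq_vortCirc)
open Summit.NavierStokesRegularity.NavierStokesRegularity.Theorems.AveragedConeLiouville.CircleCalculus (deriv_circ_z)
open Summit.NavierStokesRegularity.NavierStokesRegularity.Theorems.AveragedConeLiouville.CircMonotone
  (circ_zero circ_mono circ_nonneg vortCirc_nonneg)
open Summit.NavierStokesRegularity.NavierStokesRegularity.Theorems.HalfSpaceWindowDoorCirculationCarryingRigidityAxisCirculation
  (contDiff_circF isSmoothSpaceTimeOn_circF isSmoothSpaceTimeOn_of_class fderiv_circF_eR laplacian_circF hasDerivAt_circF_time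
    contDiffOn_circ)
open Summit.NavierStokesRegularity.NavierStokesRegularity.Theorems.AxisTwistDoorAveragedConeLiouvilleAxisLift
  (lift gradient_lift contDiffAt_lift)

open Summit.NavierStokesRegularity.NavierStokesRegularity.Theorems.HalfSpaceWindowDoorCirculationCarryingRigidityConeFluxSubsolution


open Summit.NavierStokesRegularity.NavierStokesRegularity.Theorems.HalfSpaceWindowDoorCirculationCarryingRigidityEddyMeans
  (fderiv_circF_eZ)
open Summit.NavierStokesRegularity.NavierStokesRegularity.Theorems.HalfSpaceWindowDoorCirculationCarryingRigidityFlatTools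
  (inner_self_eR)

variable {C : ℝ} {v : ℝ → EuclideanSpace ℝ (Fin 3) → EuclideanSpace ℝ (Fin 3)}

set_option maxHeartbeats 400000 in
/-- **The circle integrals at a touching point.**  For a door-class profile, `t < 0`, an off-axis point `x`, and reals `μ, κ, ε, E`: if
`∇[(2π)⁻¹Γ(|·_h|,·₂,t) − (2π)⁻¹(μ + κ(y₀²+y₁²))](x) = ε·(E·2⟪x,·⟫)`, then `∮_{S(|x_h|,x₂)}ω₃ dl = (4πεE + 2κ)|x_h|` and
`∮_{S(|x_h|,x₂)}ω_r dl = −4πεE·x₂`. -/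
theorem circ_integrals_of_touching (hv : InDoorClass C v) {t : ℝ} (ht : t < 0) {x : EuclideanSpace ℝ (Fin 3)}
    (hx : cylRadius x ≠ 0) {μ κ ε E : ℝ}
    (hgrad : fderiv ℝ (fun y : EuclideanSpace ℝ (Fin 3) =>
        (2 * Real.pi)⁻¹ * circ v (cylRadius y) (y 2) t - (2 * Real.pi)⁻¹ * (μ + κ * (y 0 * y 0 + y 1 * y 1))) x =
      ε • (E • ((2 : ℝ) • innerSL ℝ x))) :
    vortCirc v (cylRadius x) (x 2) t = (4 * Real.pi * ε * E + 2 * κ) * cylRadius x ∧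
      radVortCirc v (cylRadius x) (x 2) t = -(4 * Real.pi * ε * E * x 2) := by
  have hsm := isSmoothSpaceTimeOn_of_class hv.1 hv.2.1 hv.2.2.1 hv.2.2.2
  have h2π : 0 < 2 * Real.pi := by positivity
  set ρ := cylRadius x with hρ
  have hρ2 : ρ ^ 2 = x 0 * x 0 + x 1 * x 1 := by rw [cylRadius_sq x]; ring
  set F : EuclideanSpace ℝ (Fin 3) → ℝ := fun y => (2 * Real.pi)⁻¹ * circ v (cylRadius y) (y 2) t with hF
  set φ : EuclideanSpace ℝ (Fin 3) → ℝ := fun y => (2 * Real.pi)⁻¹ * (μ + κ * (y 0 * y 0 + y 1 * y 1)) with hφ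
  have hF2 : ContDiff ℝ 2 F := contDiff_circF ((hsm.contDiff_slice ht).of_le (by norm_cast))
  have hproj : ∀ (i : Fin 3) (w : EuclideanSpace ℝ (Fin 3)), EuclideanSpace.proj (𝕜 := ℝ) i w = w i := fun i w => rfl
  have hQ := HalfSpaceWindowDoorCirculationCarryingRigidityConeFluxSubsolution.hasFDerivAt_horizSq x
  have hφ_has : HasFDerivAt φ
      ((2 * Real.pi)⁻¹ • (κ • ((x 0 • EuclideanSpace.proj (𝕜 := ℝ) (0 : Fin 3) + x 0 • EuclideanSpace.proj (𝕜 := ℝ) (0 : Fin 3)) +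
        (x 1 • EuclideanSpace.proj (𝕜 := ℝ) (1 : Fin 3) + x 1 • EuclideanSpace.proj (𝕜 := ℝ) (1 : Fin 3))))) x :=
    ((hQ.const_mul κ).const_add μ).const_mul ((2 * Real.pi)⁻¹)
  have heR0 : (Literature.Analysis.FluidPDE.eR x) 0 = ρ⁻¹ * x 0 := by simp [Literature.Analysis.FluidPDE.eR, hρ]
  have heR1 : (Literature.Analysis.FluidPDE.eR x) 1 = ρ⁻¹ * x 1 := by simp [Literature.Analysis.FluidPDE.eR, hρ]
  have heZ0 : (eZ : EuclideanSpace ℝ (Fin 3)) 0 = 0 := by simp [eZ]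
  have heZ1 : (eZ : EuclideanSpace ℝ (Fin 3)) 1 = 0 := by simp [eZ]
  have hφ_dir : ∀ a' c' : ℝ, fderiv ℝ φ x (a' • Literature.Analysis.FluidPDE.eR x + c' • (eZ : EuclideanSpace ℝ (Fin 3))) =
      (2 * Real.pi)⁻¹ * (κ * (a' * (2 * ρ))) := by
    intro a' c'
    have hw0 : (a' • Literature.Analysis.FluidPDE.eR x + c' • (eZ : EuclideanSpace ℝ (Fin 3))) 0 = a' * (ρ⁻¹ * x 0) := by
      rw [PiLp.add_apply, PiLp.smul_apply, PiLp.smul_apply, smul_eq_mul, smul_eq_mul, heR0, heZ0, mul_zero, add_zero]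
    have hw1 : (a' • Literature.Analysis.FluidPDE.eR x + c' • (eZ : EuclideanSpace ℝ (Fin 3))) 1 = a' * (ρ⁻¹ * x 1) := by
      rw [PiLp.add_apply, PiLp.smul_apply, PiLp.smul_apply, smul_eq_mul, smul_eq_mul, heR1, heZ1, mul_zero, add_zero]
    rw [hφ_has.fderiv]
    simp only [smul_apply, add_apply, hproj, smul_eq_mul, hw0, hw1]
    have e : x 0 * (a' * (ρ⁻¹ * x 0)) + x 0 * (a' * (ρ⁻¹ * x 0)) +
        (x 1 * (a' * (ρ⁻¹ * x 1)) + x 1 * (a' * (ρ⁻¹ * x 1))) =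
        a' * (2 * (ρ⁻¹ * (x 0 * x 0 + x 1 * x 1))) := by ring
    rw [e, ← hρ2, pow_two, ← mul_assoc ρ⁻¹, inv_mul_cancel₀ hx, one_mul]
  -- `DF[w] = Dq[w] + Dφ[w]`
  have hF_dir : ∀ w : EuclideanSpace ℝ (Fin 3), fderiv ℝ F x w = ε * (E * (2 * ⟪x, w⟫_ℝ)) + fderiv ℝ φ x w := by
    intro w
    have hq : (fun y => F y - φ y) = fun y : EuclideanSpace ℝ (Fin 3) =>
        (2 * Real.pi)⁻¹ * circ v (cylRadius y) (y 2) t - (2 * Real.pi)⁻¹ * (μ + κ * (y 0 * y 0 + y 1 * y 1)) := rfl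
    have hFd : DifferentiableAt ℝ F x := (hF2.differentiable (by norm_num)).differentiableAt
    have e : F = fun y => (F y - φ y) + φ y := by funext y; ring
    have hqd : DifferentiableAt ℝ (fun y => F y - φ y) x := hFd.sub hφ_has.differentiableAt
    rw [e, fderiv_fun_add hqd hφ_has.differentiableAt]
    show fderiv ℝ (fun y => F y - φ y) x w + fderiv ℝ φ x w = _
    rw [hq, hgrad]
    simp [smul_eq_mul]
  have hFr := fderiv_circF_eR hsm ht x
  have hFz := fderiv_circF_eZ hsm ht hx
  constructor
  · -- `(2π)⁻¹∮ω₃ dl = 2εEρ + (2π)⁻¹·2κρ`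
    have h1 : (2 * Real.pi)⁻¹ * vortCirc v ρ (x 2) t = ε * (E * (2 * ρ)) + (2 * Real.pi)⁻¹ * (κ * (1 * (2 * ρ))) := by
      rw [← hFr, hF_dir, inner_self_eR, ← hρ, ← hφ_dir 1 0, one_smul, zero_smul, add_zero]
    have := congrArg (fun u => 2 * Real.pi * u) h1
    simp only at this
    rw [← mul_assoc, mul_inv_cancel₀ h2π.ne', one_mul] at this
    rw [this]; field_simp; ring
  · -- `−(2π)⁻¹∮ω_r dl = 2εE x₂`
    have heZin : ⟪x, (eZ : EuclideanSpace ℝ (Fin 3))⟫_ℝ = x 2 := by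
      rw [real_inner_comm, eZ, EuclideanSpace.inner_single_left]; simp
    have hφZ : fderiv ℝ φ x (eZ : EuclideanSpace ℝ (Fin 3)) = 0 := by
      have := hφ_dir 0 1
      rw [zero_smul, one_smul, zero_add] at this
      rw [this]; ring
    have h1 : -((2 * Real.pi)⁻¹ * radVortCirc v ρ (x 2) t) = ε * (E * (2 * x 2)) := by
      rw [← hFz, hF_dir, heZin, hφZ, add_zero]
    have := congrArg (fun u => -(2 * Real.pi) * u) h1
    simp only at this
    rw [neg_mul, mul_neg, neg_neg, ← mul_assoc, mul_inv_cancel₀ h2π.ne', one_mul] at this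
    rw [this]; ring

end Summit.NavierStokesRegularity.NavierStokesRegularity.Theorems.HalfSpaceWindowDoorCirculationCarryingRigidityFlatTouching

end
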